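import Literature.Computability.AlgebraicComplexity.DIP20Prop51Certificates47U28A
import HarnessLib

set_option Elab.async false
set_option maxRecDepth 100000

/-!
# Dörfler–Ikenmeyer–Panova 2020, Prop. 5.1, the `Ch_4^7` half — kernel certificate for the row `(14, 14, 11, 3)`, PART B (DIP20Prop51Certificates47U28B)

Topic `Literature/Computability/AlgebraicComplexity`; certificate file (cell `val-lit`, unit val-lit-t06 g4, generated with
val-lit-t07 g4's `gen47.py` from this seat's certificate record `HOME/bip/t06g4-cert47-j268387.json` (column-symmetrised
record, engine `S`; kit j268387 = t07's search47.py with type fillings) and SPLIT by hand into three parts so that no part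
exceeds the gate's elaboration budget: part A (`DIP20Prop51Certificates47U28A`) holds the data `def`s (network, integer Chow
point, content table, the literal intermediate layers after the labels `1`, `2`, `3`) and kernel chunks 1–2;
THIS part B holds kernel chunk 3 (the label `3`: from `chow47Layer_14_14_11_3_3` to `chow47Layer_14_14_11_3_4`, 37687
transitions on the desk); part C (`DIP20Prop51Certificates47U28C`) holds the last chunk, the recombined value and the closer
`coordRingMultiplicity_chowSet_rowDual_14_14_11_3_seven_pos`. No new definition, no new fact: one kernel theorem.
D-0014 sibling of `DIP20MultiplicityObstructions.lean`, named fact `DIP20_prop_5_1`, SECOND conjunct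
`∀ μ ∈ dipGenerators47, 0 < coordRingMultiplicity ℂ (chowSet ℂ 4 7) 7 (rowDual μ)`.

J. Dörfler, C. Ikenmeyer, G. Panova, *On geometric complexity theory: multiplicity obstructions are stronger than
occurrence obstructions*, SIAM J. Appl. Algebra Geom. 4 (2020) = arXiv:1901.04576, Prop. 5.1 (arXiv p. 12; "Proposition 18"
of the e-print): "If `X` is defined as in Proposition 7.1, then for all `μ ∈ X` we have `mult_μ(ℂ[Ch_4^7]) > 0`" — here the row
`μ = (14, 14, 11, 3)` of `X`, `d = 6`; see part A for the full account of the replayed verification (§5, pp. 12–13: one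
highest-weight vector of a column-strict filling evaluated at one point of `Ch_4^7`; §8, pp. 17–19).

HONEST FRAMING: replay of a published computer verification in the toy model `Ch_4^7` (Chow variety versus power sums);
nothing here bears on permanent versus determinant; VP ≠ VNP is not proved.

## References

* J. Dörfler, C. Ikenmeyer, G. Panova, SIAM J. Appl. Algebra Geom. 4 (2020) = arXiv:1901.04576, Prop. 5.1 and §5
  (arXiv pp. 12–13), Prop. 7.1 (the set `X`, p. 16), §8 (the tableaux, pp. 17–19). [DorflerIkenmeyerPanova2020]

## Mathlib and tree

Tree: part A of this certificate (`chow47Net_14_14_11_3`, `chow47Tab_14_14_11_3`, `chow47Layer_14_14_11_3_3`,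
`chow47Layer_14_14_11_3_4`); `layersS`, `tableTrie` (`TableauEvalLabelMajorSymm`, val-lit-t07 g4). Mathlib: `decide +kernel`.
-/


namespace Literature.Computability.AlgebraicComplexity

namespace TableauEval

/-- Kernel chunk 3: the labels `3, …, 3` lead from `chow47Layer_14_14_11_3_3` to `chow47Layer_14_14_11_3_4` (37687 transitions on the desk). [cite: DorflerIkenmeyerPanova2020, Prop. 5.1 and §5, §8 (arXiv pp. 12–13, 17–19)] -/
theorem chow47Layer_14_14_11_3_4_eq :
    layersS chow47Net_14_14_11_3.cols chow47Net_14_14_11_3.varBound (tableTrie chow47Net_14_14_11_3.varBound chow47Tab_14_14_11_3 chow47Net_14_14_11_3.perLabel [])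
      (List.range' 3 1) chow47Layer_14_14_11_3_3 = chow47Layer_14_14_11_3_4 := by
  decide +kernel


end TableauEval

end Literature.Computability.AlgebraicComplexity
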